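import Mathlib.Analysis.SpecialFunctions.SmoothTransition
import Mathlib.Analysis.SpecialFunctions.Sqrt
import Mathlib.Analysis.Calculus.Deriv.Slope
import Literature.Geometry.Lorentzian.KerrHorizonCausality
import HarnessLib

/-!
# Smoothed indicators of domains of dependence in the ingoing Kerr–Schild chart: the cone and
# horizon cutoffs, their differentials, and the sign of the weighted flux

(family `gr`; infrastructure for the proof of `kerr_finite_speed_of_propagation`
(`KerrWaveEnergy.lean`) by the weighted conservation theorem of `KerrSchildLocalEnergy.lean`;
namespaces `Literature.Geometry.Lorentzian`, `Literature.Geometry.Lorentzian.Kerr`)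

The weight fed to `KerrSchild.Background.fderiv_eq_zero_of_weight` for the Kerr exterior is a
product `W = η(t*) · χ(q₁) · χ(q₂)` of Mathlib's `Real.smoothTransition =: χ` applied to

* the **cone argument** `q₁(t*, y) = R − t* − (ε² + ‖y − y₀‖²)^{1/2}` — its differential is
  `−(dt* + n⃗·dy⃗)` with `|n⃗| = ‖y − y₀‖/(ε² + ‖y − y₀‖²)^{1/2} < 1`, minus a cone covector
  (`KerrSchild.Background.coneCovector_causal`): the sets `{q₁ > 0}` shrink at coordinate speed
  `≥ 1`, faster than light for `η + φ ℓ ⊗ ℓ`, `φ ≥ 0` (Kerr–Schild 1965, §2);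
* the **horizon argument** `q₂(t*, y) = δ⁻¹ (r(y) − r_in(t*))`, `r_in(t*) = r₊ + ε e^{(t* − t₀)/(2M)}`
  — its differential is `−δ⁻¹ (ṙ_in dt* − dr)`, minus a multiple of the past causal covector of
  `Kerr.horizonCovector_causal` (DRSR arXiv:1402.7034, §2.2.5: past causal curves in `{r > r₊}` do
  not reach `𝓗⁺` in finite `t*`);
* a time cutoff `η(t*) = χ(2t* + 2)`, equal to `1` for `t* ≥ −1/2`.

This file records the calculus of these arguments (`hasFDerivAt_sqrt_sq_add_norm_sq`,
`coneArg_hasFDerivAt`, `Kerr.horizonArg_hasFDerivAt`, smoothness) and the abstract sign lemma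
`sum_fderiv_smoothTransition_mul_le`: for `W = χ(q₁) χ(q₂)` near a point,
`∑_μ ∂_μW P^μ = χ(q₂) χ'(q₁) ∑_μ ∂_μq₁ P^μ + χ(q₁) χ'(q₂) ∑_μ ∂_μq₂ P^μ ≤ 0` as soon as
`∑ ∂_μq₁ P^μ ≤ 0` and either `χ'(q₂) = 0` or `∑ ∂_μq₂ P^μ ≤ 0` (`χ, χ' ≥ 0`) — the "flux through
the lateral boundary has a sign" step of Hawking–Ellis's Lemma 4.3.1 for smoothed regions.

## References

* S. W. Hawking, G. F. R. Ellis, *The large scale structure of space-time*, CUP 1973, §4.3,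
  Lemma 4.3.1 (key `HawkingEllis1973CUP`).
* M. Dafermos, I. Rodnianski, Y. Shlapentokh-Rothman, arXiv:1402.7034, §2.2.5
  (key `DafermosRodnianskiShlapentokhrothman2014`).
* R. P. Kerr, A. Schild, 1965, §2 (key `KerrSchild1965`).
-/

noncomputable section

open Set Filter
open scoped Topology RealInnerProductSpace ContDiff

namespace Literature.Geometry.Lorentzian

/-! ### `Real.smoothTransition`: sign of the derivative, local constancy above `1` -/

/-- `χ' ≥ 0` for Mathlib's monotone smooth transition `χ`. [folklore] -/
theorem deriv_smoothTransition_nonneg (u : ℝ) : 0 ≤ deriv Real.smoothTransition u :=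
  Real.smoothTransition.monotone.deriv_nonneg

/-- `χ' = 0` on `(1, ∞)`, where `χ ≡ 1`. [folklore] -/
theorem deriv_smoothTransition_eq_zero_of_one_lt {u : ℝ} (hu : 1 < u) :
    deriv Real.smoothTransition u = 0 := by
  have h : Real.smoothTransition =ᶠ[𝓝 u] fun _ ↦ (1 : ℝ) := by
    filter_upwards [Ioi_mem_nhds hu] with v hv
    exact Real.smoothTransition.one_of_one_le (le_of_lt hv)
  rw [h.deriv_eq, deriv_const]

/-- Chain rule: `d(χ ∘ q)_z = χ'(q z) dq_z` for `q` differentiable at `z`. [folklore] -/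
theorem hasFDerivAt_smoothTransition_comp {q : E4 → ℝ} {q' : E4 →L[ℝ] ℝ} {z : E4}
    (hq : HasFDerivAt q q' z) :
    HasFDerivAt (fun w ↦ Real.smoothTransition (q w))
      (deriv Real.smoothTransition (q z) • q') z :=
  ((Real.smoothTransition.contDiff (n := 1)).differentiable one_ne_zero _).hasDerivAt
    |>.comp_hasFDerivAt z hq

/-! ### The time cutoff `η(t*) = χ(2t* + 2)` -/

/-- The time cutoff `z ↦ χ(2 z⁰ + 2)` is smooth. [folklore] -/
theorem contDiff_slabTimeCutoff {n : ℕ∞} :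
    ContDiff ℝ n fun z : E4 ↦ Real.smoothTransition (2 * z 0 + 2) :=
  Real.smoothTransition.contDiff.comp
    ((contDiff_const.mul (Kerr.contDiff_coord 0)).add contDiff_const)

/-- The time cutoff is `1` near every point with `z⁰ > −1/2`. [folklore] -/
theorem slabTimeCutoff_eventuallyEq_one {z : E4} (hz : -2⁻¹ < z 0) :
    (fun w : E4 ↦ Real.smoothTransition (2 * w 0 + 2)) =ᶠ[𝓝 z] fun _ ↦ 1 := by
  have hopen : IsOpen {w : E4 | -2⁻¹ < w 0} := isOpen_lt continuous_const (E4.dx 0).continuous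
  filter_upwards [hopen.mem_nhds hz] with w hw
  have hw' : -2⁻¹ < w 0 := hw
  exact Real.smoothTransition.one_of_one_le (by linarith)

/-- Where the time cutoff is nonzero, `z⁰ > −1`. [folklore] -/
theorem neg_one_lt_of_slabTimeCutoff_ne_zero {z : E4} (hz : Real.smoothTransition (2 * z 0 + 2) ≠ 0) :
    -1 < z 0 := by
  by_contra h
  exact hz (Real.smoothTransition.zero_of_nonpos (by linarith [not_lt.mp h]))

/-! ### The smoothed distance `(ε² + ‖v‖²)^{1/2}` and the cone argument -/

/-- **`d (ε² + ‖v‖²)^{1/2} = ⟨v, ·⟩/(ε² + ‖v‖²)^{1/2}`** (`ε ≠ 0`). [folklore] -/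
theorem hasFDerivAt_sqrt_sq_add_norm_sq {ε : ℝ} (hε : ε ≠ 0) (v : E3) :
    HasFDerivAt (fun v : E3 ↦ √(ε ^ 2 + ‖v‖ ^ 2))
      ((√(ε ^ 2 + ‖v‖ ^ 2))⁻¹ • (innerSL ℝ v : E3 →L[ℝ] ℝ)) v := by
  have hpos : 0 < ε ^ 2 + ‖v‖ ^ 2 := by positivity
  have h1 : HasFDerivAt (fun v : E3 ↦ ε ^ 2 + ‖v‖ ^ 2) (2 • (innerSL ℝ v : E3 →L[ℝ] ℝ)) v :=
    (hasStrictFDerivAt_norm_sq v).hasFDerivAt.const_add _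
  have h2 := (Real.hasDerivAt_sqrt hpos.ne').comp_hasFDerivAt v h1
  refine h2.congr_fderiv ?_
  ext w
  simp only [FunLike.coe_smul, Pi.smul_apply, smul_eq_mul, two_smul, add_apply,
    innerSL_apply_apply]
  have hs : √(ε ^ 2 + ‖v‖ ^ 2) ≠ 0 := (Real.sqrt_pos.mpr hpos).ne'
  field_simp
  ring

/-- The smoothed distance is smooth (`ε ≠ 0`). [folklore] -/
theorem contDiff_sqrt_sq_add_norm_sq {ε : ℝ} (hε : ε ≠ 0) {n : ℕ∞} :
    ContDiff ℝ n fun v : E3 ↦ √(ε ^ 2 + ‖v‖ ^ 2) :=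
  (contDiff_const.add (contDiff_norm_sq ℝ)).sqrt fun v ↦ by positivity

/-- `‖v‖ ≤ (ε² + ‖v‖²)^{1/2}`. [folklore] -/
theorem norm_le_sqrt_sq_add_norm_sq (ε : ℝ) (v : E3) : ‖v‖ ≤ √(ε ^ 2 + ‖v‖ ^ 2) :=
  calc ‖v‖ = |‖v‖| := (abs_norm v).symm
    _ ≤ √(ε ^ 2 + ‖v‖ ^ 2) := Real.abs_le_sqrt (by nlinarith [sq_nonneg ε])

/-- `|ε| ≤ (ε² + ‖v‖²)^{1/2}`. [folklore] -/
theorem abs_le_sqrt_sq_add_norm_sq (ε : ℝ) (v : E3) : |ε| ≤ √(ε ^ 2 + ‖v‖ ^ 2) :=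
  Real.abs_le_sqrt (by nlinarith [norm_nonneg v])

/-- **The differential of the cone argument `q₁(z) = R − z⁰ − (ε² + ‖z⃗ − y₀‖²)^{1/2}`**:
`dq₁ = −dt* − ⟨z⃗ − y₀, dz⃗⟩/(ε² + ‖z⃗ − y₀‖²)^{1/2}`. [folklore] -/
theorem coneArg_hasFDerivAt {ε : ℝ} (hε : ε ≠ 0) (R : ℝ) (y₀ : E3) (z : E4) :
    HasFDerivAt (fun w : E4 ↦ R - w 0 - √(ε ^ 2 + ‖E4.spatial w - y₀‖ ^ 2))
      ((0 : E4 →L[ℝ] ℝ) - E4.dx 0 -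
        ((√(ε ^ 2 + ‖E4.spatial z - y₀‖ ^ 2))⁻¹ •
          (innerSL ℝ (E4.spatial z - y₀) : E3 →L[ℝ] ℝ)).comp E4.spatial) z := by
  have h0 : HasFDerivAt (fun w : E4 ↦ w 0) (E4.dx 0) z := (E4.dx 0).hasFDerivAt
  have hsp : HasFDerivAt (fun w : E4 ↦ E4.spatial w - y₀) E4.spatial z :=
    E4.spatial.hasFDerivAt.sub_const y₀
  have hsq := (hasFDerivAt_sqrt_sq_add_norm_sq hε (E4.spatial z - y₀)).comp z hsp
  exact ((hasFDerivAt_const R z).sub h0).sub hsq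

/-- The cone argument is smooth (`ε ≠ 0`). [folklore] -/
theorem contDiff_coneArg {ε : ℝ} (hε : ε ≠ 0) (R : ℝ) (y₀ : E3) {n : ℕ∞} :
    ContDiff ℝ n fun w : E4 ↦ R - w 0 - √(ε ^ 2 + ‖E4.spatial w - y₀‖ ^ 2) :=
  (contDiff_const.sub (Kerr.contDiff_coord 0)).sub
    ((contDiff_sqrt_sq_add_norm_sq hε).comp (E4.spatial.contDiff.sub contDiff_const))

/-- **Components of `dq₁`**: `dq₁(∂₀) = −1` and `dq₁(∂_{i+1}) = −(z⃗ − y₀)_i/(ε² + ‖z⃗ − y₀‖²)^{1/2}`.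
[folklore] -/
theorem coneArg_fderiv_apply {ε : ℝ} (hε : ε ≠ 0) (R : ℝ) (y₀ : E3) (z : E4) :
    fderiv ℝ (fun w : E4 ↦ R - w 0 - √(ε ^ 2 + ‖E4.spatial w - y₀‖ ^ 2)) z (E4.basisVector 0)
        = -1 ∧
      ∀ i : Fin 3, fderiv ℝ (fun w : E4 ↦ R - w 0 - √(ε ^ 2 + ‖E4.spatial w - y₀‖ ^ 2)) z
          (E4.basisVector i.succ) =
        -((E4.spatial z - y₀) i / √(ε ^ 2 + ‖E4.spatial z - y₀‖ ^ 2)) := by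
  rw [(coneArg_hasFDerivAt hε R y₀ z).fderiv]
  constructor
  · simp only [sub_apply, ContinuousLinearMap.comp_apply, E4.spatial_basisVector_zero, map_zero,
      sub_zero, zero_sub]
    simp
  · intro i
    simp only [sub_apply, ContinuousLinearMap.comp_apply, E4.spatial_basisVector_succ,
      FunLike.coe_smul, Pi.smul_apply, innerSL_apply_apply, EuclideanSpace.inner_single_right,
      conj_trivial, one_mul, smul_eq_mul]
    simp [div_eq_inv_mul, (Fin.succ_ne_zero i).symm]

/-- **The cone covector is causal and co-oriented with `dt*`**: for `ν = −dq₁(∂_·)` one has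
`ν₀ = 1` and `ν₁² + ν₂² + ν₃² = ‖z⃗ − y₀‖²/(ε² + ‖z⃗ − y₀‖²) ≤ 1`, so
`KerrSchild.Background.coneCovector_causal` applies on every background. [cite: KerrSchild1965, §2] -/
theorem coneArg_covector {ε : ℝ} (hε : ε ≠ 0) (R : ℝ) (y₀ : E3) (z : E4) :
    (-fderiv ℝ (fun w : E4 ↦ R - w 0 - √(ε ^ 2 + ‖E4.spatial w - y₀‖ ^ 2)) z
        (E4.basisVector 0) = 1) ∧
      (-fderiv ℝ (fun w : E4 ↦ R - w 0 - √(ε ^ 2 + ‖E4.spatial w - y₀‖ ^ 2)) z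
          (E4.basisVector 1)) ^ 2 +
        (-fderiv ℝ (fun w : E4 ↦ R - w 0 - √(ε ^ 2 + ‖E4.spatial w - y₀‖ ^ 2)) z
          (E4.basisVector 2)) ^ 2 +
        (-fderiv ℝ (fun w : E4 ↦ R - w 0 - √(ε ^ 2 + ‖E4.spatial w - y₀‖ ^ 2)) z
          (E4.basisVector 3)) ^ 2 ≤ 1 := by
  obtain ⟨h0, hi⟩ := coneArg_fderiv_apply hε R y₀ z
  refine ⟨by rw [h0]; norm_num, ?_⟩
  have h1 := hi 0
  have h2 := hi 1
  have h3 := hi 2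
  simp only [Fin.succ_zero_eq_one, Fin.succ_one_eq_two] at h1 h2
  have h33 : (Fin.succ 2 : Fin 4) = 3 := rfl
  rw [h33] at h3
  rw [h1, h2, h3]
  set v : E3 := E4.spatial z - y₀ with hv
  set s : ℝ := √(ε ^ 2 + ‖v‖ ^ 2) with hs
  have hpos : 0 < ε ^ 2 + ‖v‖ ^ 2 := by positivity
  have hs0 : 0 < s := Real.sqrt_pos.mpr hpos
  have hs2 : s ^ 2 = ε ^ 2 + ‖v‖ ^ 2 := Real.sq_sqrt hpos.le
  have hvn : ‖v‖ ^ 2 = v 0 ^ 2 + v 1 ^ 2 + v 2 ^ 2 := E3.norm_sq v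
  simp only [neg_neg, div_pow]
  rw [← add_div, ← add_div, div_le_one (by positivity), hs2, hvn]
  nlinarith [sq_nonneg ε]

/-! ### The horizon argument `q₂(z) = δ⁻¹ (r(z) − r_in(z⁰))` -/

namespace Kerr

/-- The **inner radius** profile `r_in(t) = r_p + ε e^{(t − t₀)/(2M)}` has derivative
`ṙ_in(t) = ε e^{(t − t₀)/(2M)}/(2M) = (r_in(t) − r_p)/(2M)`. [folklore] -/
theorem hasDerivAt_innerRadius (rp ε t₀ M t : ℝ) :
    HasDerivAt (fun t : ℝ ↦ rp + ε * Real.exp ((t - t₀) / (2 * M)))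
      (ε * Real.exp ((t - t₀) / (2 * M)) / (2 * M)) t := by
  have h := ((((hasDerivAt_id t).sub_const t₀).div_const (2 * M)).exp.const_mul ε).const_add rp
  exact h.congr_deriv (by simp only [id_eq]; ring)

/-- **The differential of the horizon argument** `q₂(z) = δ⁻¹ (r(z) − r_in(z⁰))` at a point with
`r > 0`: `dq₂ = δ⁻¹ (dr − ṙ_in(z⁰) dt*)`, `dr = ⟨∇r, dz⃗⟩` (`Kerr.hasFDerivAt_radius`). [folklore] -/
theorem horizonArg_hasFDerivAt (rp ε t₀ M δ : ℝ) {a : ℝ} {z : E4} (hz : 0 < radius a z) :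
    HasFDerivAt
      (fun w : E4 ↦ δ⁻¹ * (radius a w - (rp + ε * Real.exp ((w 0 - t₀) / (2 * M)))))
      (δ⁻¹ • ((radiusGrad a (E4.spatial z)).comp E4.spatial -
        (ε * Real.exp ((z 0 - t₀) / (2 * M)) / (2 * M)) • E4.dx 0)) z := by
  have hr := hasFDerivAt_radius hz
  have h0 : HasFDerivAt (fun w : E4 ↦ w 0) (E4.dx 0) z := (E4.dx 0).hasFDerivAt
  have h := (hasDerivAt_innerRadius rp ε t₀ M (z 0)).comp_hasFDerivAt z h0
  have hin : HasFDerivAt (fun w : E4 ↦ rp + ε * Real.exp ((w 0 - t₀) / (2 * M)))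
      ((ε * Real.exp ((z 0 - t₀) / (2 * M)) / (2 * M)) • E4.dx 0) z := h
  exact (hr.sub hin).const_mul δ⁻¹

/-- The horizon argument is smooth at points with `r > 0`. [folklore] -/
theorem contDiffAt_horizonArg (rp ε t₀ M δ : ℝ) {a : ℝ} {z : E4} (hz : 0 < radius a z)
    {n : ℕ∞} :
    ContDiffAt ℝ n
      (fun w : E4 ↦ δ⁻¹ * (radius a w - (rp + ε * Real.exp ((w 0 - t₀) / (2 * M))))) z := by
  have hin : ContDiff ℝ n fun w : E4 ↦ rp + ε * Real.exp ((w 0 - t₀) / (2 * M)) :=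
    contDiff_const.add (contDiff_const.mul
      (Real.contDiff_exp.comp (((contDiff_coord 0).sub contDiff_const).div_const _)))
  exact contDiffAt_const.mul ((contDiffAt_radius hz).sub hin.contDiffAt)

/-- **Components of `dq₂`**: `dq₂(∂₀) = −δ⁻¹ ṙ_in(z⁰)`, `dq₂(∂_{i+1}) = δ⁻¹ (∇r)_i`.
[folklore] -/
theorem horizonArg_fderiv_apply (rp ε t₀ M δ : ℝ) {a : ℝ} {z : E4} (hz : 0 < radius a z) :
    fderiv ℝ (fun w : E4 ↦ δ⁻¹ * (radius a w - (rp + ε * Real.exp ((w 0 - t₀) / (2 * M))))) z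
        (E4.basisVector 0) = -(δ⁻¹ * (ε * Real.exp ((z 0 - t₀) / (2 * M)) / (2 * M))) ∧
      ∀ i : Fin 3,
        fderiv ℝ (fun w : E4 ↦ δ⁻¹ * (radius a w - (rp + ε * Real.exp ((w 0 - t₀) / (2 * M)))))
            z (E4.basisVector i.succ) = δ⁻¹ * radiusGradVec a (E4.spatial z) i := by
  rw [(horizonArg_hasFDerivAt rp ε t₀ M δ hz).fderiv]
  constructor
  · simp only [FunLike.coe_smul, Pi.smul_apply, sub_apply, ContinuousLinearMap.comp_apply,
      E4.spatial_basisVector_zero, map_zero, smul_eq_mul]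
    have : (E4.dx 0) (E4.basisVector 0) = 1 := by simp
    rw [this]
    ring
  · intro i
    simp only [FunLike.coe_smul, Pi.smul_apply, sub_apply, ContinuousLinearMap.comp_apply,
      E4.spatial_basisVector_succ, radiusGrad_single, smul_eq_mul]
    have : (E4.dx 0) (E4.basisVector i.succ) = 0 := by
      simp [(Fin.succ_ne_zero i).symm]
    rw [this]
    ring

end Kerr

/-! ### The sign of the weighted flux for a product of two transitions -/

/-- **The flux through a smoothed lateral boundary has a sign.** Let `W = χ(q₁) χ(q₂)` near `z`
(`χ = Real.smoothTransition`, `q₁, q₂` differentiable at `z`) and `P^μ` any current. Then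
`∑_μ ∂_μW(z) P^μ = χ(q₂) χ'(q₁) ∑_μ ∂_μq₁ P^μ + χ(q₁) χ'(q₂) ∑_μ ∂_μq₂ P^μ ≤ 0` provided
`∑_μ ∂_μq₁(z) P^μ ≤ 0` and either `χ'(q₂(z)) = 0` or `∑_μ ∂_μq₂(z) P^μ ≤ 0` (`χ, χ' ≥ 0`). With
`−dq_i` past causal conormals and `P^μ = T^{μ0}` this is the lateral-boundary step of
Hawking–Ellis's Lemma 4.3.1 for smoothed regions. [cite: HawkingEllis1973CUP, §4.3 Lemma 4.3.1] -/
theorem sum_fderiv_smoothTransition_mul_le {W q₁ q₂ : E4 → ℝ} {z : E4} (P : Fin 4 → ℝ)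
    (hW : W =ᶠ[𝓝 z] fun w ↦ Real.smoothTransition (q₁ w) * Real.smoothTransition (q₂ w))
    (hq₁ : DifferentiableAt ℝ q₁ z) (hq₂ : DifferentiableAt ℝ q₂ z)
    (h₁ : ∑ μ, fderiv ℝ q₁ z (E4.basisVector μ) * P μ ≤ 0)
    (h₂ : deriv Real.smoothTransition (q₂ z) = 0 ∨
      ∑ μ, fderiv ℝ q₂ z (E4.basisVector μ) * P μ ≤ 0) :
    ∑ μ, fderiv ℝ W z (E4.basisVector μ) * P μ ≤ 0 := by
  have hc₁ := hasFDerivAt_smoothTransition_comp hq₁.hasFDerivAt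
  have hc₂ := hasFDerivAt_smoothTransition_comp hq₂.hasFDerivAt
  have hprod := hc₁.fun_mul hc₂
  rw [hW.fderiv_eq, hprod.fderiv]
  have hμ : ∀ μ, (Real.smoothTransition (q₁ z) •
      (deriv Real.smoothTransition (q₂ z) • fderiv ℝ q₂ z) +
      Real.smoothTransition (q₂ z) •
        (deriv Real.smoothTransition (q₁ z) • fderiv ℝ q₁ z)) (E4.basisVector μ) * P μ =
      Real.smoothTransition (q₁ z) * deriv Real.smoothTransition (q₂ z) *
          (fderiv ℝ q₂ z (E4.basisVector μ) * P μ) +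
        Real.smoothTransition (q₂ z) * deriv Real.smoothTransition (q₁ z) *
          (fderiv ℝ q₁ z (E4.basisVector μ) * P μ) := by
    intro μ
    simp only [add_apply, FunLike.coe_smul, Pi.smul_apply, smul_eq_mul]
    ring
  simp only [hμ, Finset.sum_add_distrib, ← Finset.mul_sum]
  have hA : Real.smoothTransition (q₂ z) * deriv Real.smoothTransition (q₁ z) *
      ∑ μ, fderiv ℝ q₁ z (E4.basisVector μ) * P μ ≤ 0 :=
    mul_nonpos_of_nonneg_of_nonpos
      (mul_nonneg (Real.smoothTransition.nonneg _) (deriv_smoothTransition_nonneg _)) h₁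
  have hB : Real.smoothTransition (q₁ z) * deriv Real.smoothTransition (q₂ z) *
      ∑ μ, fderiv ℝ q₂ z (E4.basisVector μ) * P μ ≤ 0 := by
    rcases h₂ with h | h
    · rw [h, mul_zero, zero_mul]
    · exact mul_nonpos_of_nonneg_of_nonpos
        (mul_nonneg (Real.smoothTransition.nonneg _) (deriv_smoothTransition_nonneg _)) h
  linarith

end Literature.Geometry.Lorentzian

end
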